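import Mathlib
import HarnessLib
import Summits.ValiantsHypothesis.ValiantsHypothesis.Theses.MonotoneRestoration
import Literature.Computability.AlgebraicComplexity.ArithCircuit
import Literature.Computability.AlgebraicComplexity.ArithCircuitProofs
import Literature.Computability.AlgebraicComplexity.MonotoneStructure
import Literature.Computability.AlgebraicComplexity.PermanentIrreducible
import Literature.ModelTheory.FiniteModelTheory.CkEquiv
import Summits.ValiantsHypothesis.ValiantsHypothesis.Theorems.MonotoneRestorationMonotoneRestorationQPCosetCount
import Summits.ValiantsHypothesis.ValiantsHypothesis.Theorems.MonotoneRestorationMonotoneRestorationQPSymmetricLB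
import Summits.ValiantsHypothesis.ValiantsHypothesis.Theorems.MonotoneRestorationMonotoneRestorationQPSupportSymmetrisation
import Summits.ValiantsHypothesis.ValiantsHypothesis.Theorems.MonotoneRestorationMonotoneRestorationQPSparseRegime
import Summits.ValiantsHypothesis.ValiantsHypothesis.Theorems.MonotoneRestorationMonotoneRestorationQPBeta
import Literature.Computability.AlgebraicComplexity.SymmetricArithCircuit
import Literature.Computability.AlgebraicComplexity.DawarWilsenach2025Proofs
import Literature.GroupTheory.PermutationGroups.SmallIndexSubgroups
import Summits.ValiantsHypothesis.ValiantsHypothesis.Theorems.MonotoneRestorationQP.Negative.LoadBearing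
import Summits.ValiantsHypothesis.ValiantsHypothesis.Theorems.MonotoneRestorationMonotoneRestorationQPPermSupportCount

/-! TTRL-lite variant V19146 of stmt-ValiantsHypothesis-15886 -/

-- `Summit.ValiantsHypothesis.ValiantsHypothesis.…` is the tree's mandated single-conjunct layout
-- (Sub = Summit), so the duplicated namespace component is intended.
set_option linter.dupNamespace false

namespace Summit.ValiantsHypothesis.ValiantsHypothesis.Theorems

open Summit.ValiantsHypothesis.ValiantsHypothesis.Theses.MonotoneRestoration
open Literature.Computability.AlgebraicComplexity

/-- TTRL-lite variant V19146 (boundary case `n = 4`) of `stub_esymmRowSums_structure` is FALSE: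
the row-sum substitution `P = e₂(R₀, R₁, R₂, R₃)` (with `Rᵢ = ∑ j, X (i, j)`) of
`esymm (Fin 4) ℝ≥0 (4 / 2)` is NOT invariant under the transposition `(i, j) ↦ (j, i)` of the
variables (its invariance group is `S₄ × S₄`, not the wreath extension by the transpose).
Witness: evaluate at the indicator `g (i, j) = [i = 0]` of row `0`.  Then `P (g) = e₂(4, 0, 0, 0) = 0`,
while the transposed polynomial evaluates to `P (g ∘ swap) = e₂(1, 1, 1, 1) = 6 ≠ 0`
(equivalently: `X (0,0) * X (0,1)` occurs in the transpose but not in `P`). -/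
theorem stub_esymmRowSums_structure_var19146_false :
    ¬ (MvPolynomial.rename (fun p : Fin 4 × Fin 4 => (p.2, p.1))
        (MvPolynomial.bind₁ (fun i : Fin 4 => ∑ j : Fin 4, MvPolynomial.X (i, j))
          (MvPolynomial.esymm (Fin 4) NNReal (4 / 2))) =
      MvPolynomial.bind₁ (fun i : Fin 4 => ∑ j : Fin 4, MvPolynomial.X (i, j))
        (MvPolynomial.esymm (Fin 4) NNReal (4 / 2))) := by
  classical
  intro h
  -- the evaluation point: indicator of row `0`
  obtain ⟨g, hg⟩ : ∃ g : Fin 4 × Fin 4 → NNReal, ∀ p, g p = if p.1 = 0 then 1 else 0 :=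
    ⟨_, fun _ => rfl⟩
  -- the un-transposed side evaluates to `e₂(4, 0, 0, 0) = 0`
  have hR : MvPolynomial.aeval g
      (MvPolynomial.bind₁ (fun i : Fin 4 => ∑ j : Fin 4, MvPolynomial.X (i, j))
        (MvPolynomial.esymm (Fin 4) NNReal (4 / 2))) = 0 := by
    rw [MvPolynomial.aeval_bind₁, MvPolynomial.aeval_esymm_eq_multiset_esymm, Finset.esymm_map_val]
    refine Finset.sum_eq_zero fun t ht => ?_
    rw [Finset.mem_powersetCard] at ht
    -- `t` has two elements, hence contains a row index `i ≠ 0`, whose row sum vanishes at `g`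
    obtain ⟨i, hi, hi0⟩ : ∃ i ∈ t, i ≠ 0 := by
      by_contra hcon
      have hsub : t ⊆ {0} := fun i hi =>
        Finset.mem_singleton.mpr (by by_contra hne; exact hcon ⟨i, hi, hne⟩)
      have hle := Finset.card_le_card hsub
      rw [Finset.card_singleton] at hle
      omega
    refine Finset.prod_eq_zero hi ?_
    rw [map_sum]
    refine Finset.sum_eq_zero fun j _ => ?_
    rw [MvPolynomial.aeval_X, hg, if_neg hi0]
  -- the transposed side evaluates to `e₂(1, 1, 1, 1) = 6 ≠ 0` (column sums of `g` are all `1`)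
  have hL : MvPolynomial.aeval g
      (MvPolynomial.rename (fun p : Fin 4 × Fin 4 => (p.2, p.1))
        (MvPolynomial.bind₁ (fun i : Fin 4 => ∑ j : Fin 4, MvPolynomial.X (i, j))
          (MvPolynomial.esymm (Fin 4) NNReal (4 / 2)))) ≠ 0 := by
    rw [MvPolynomial.aeval_rename, MvPolynomial.aeval_bind₁,
      MvPolynomial.aeval_esymm_eq_multiset_esymm, Finset.esymm_map_val]
    have hterm : ∀ t ∈ Finset.powersetCard (4 / 2) (Finset.univ : Finset (Fin 4)),
        ∏ i ∈ t, MvPolynomial.aeval (g ∘ fun p : Fin 4 × Fin 4 => (p.2, p.1))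
          (∑ j : Fin 4, (MvPolynomial.X (i, j) : MvPolynomial (Fin 4 × Fin 4) NNReal)) =
          (1 : NNReal) := by
      intro t _
      refine Finset.prod_eq_one fun i _ => ?_
      rw [map_sum]
      simp only [MvPolynomial.aeval_X, Function.comp_apply, hg]
      rw [Finset.sum_ite_eq']
      simp
    rw [Finset.sum_congr rfl hterm, Finset.sum_const, Finset.card_powersetCard, Finset.card_univ,
      Fintype.card_fin]
    have hc : Nat.choose 4 (4 / 2) = 6 := by decide
    rw [hc]
    norm_num
  rw [h] at hL
  exact hL hR

end Summit.ValiantsHypothesis.ValiantsHypothesis.Theorems
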